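import Literature.MathematicalPhysics.QuantumFieldTheory.Balaban1983to89.B9Thm37GlueTorusCovCT
import Literature.MathematicalPhysics.QuantumFieldTheory.Balaban1983to89.B9Thm37GlueTorusCovTowerDir

/-!
# Beta / CovariantTowerDecay — COMBES–THOMAS EXPONENTIAL DECAY OF THE INVERSE OF THE k-FOLD COVARIANT TOWER
# OPERATOR Δ_U + Σ_{l≤k} a_l·G_lᵀG_l (the (3.16)/(3.23) SHAPE of [B9] with k-fold covariant averaging),
# UNIFORM IN THE TRANSPORT U, with an explicit rate functional κ_k(θ) and the constant 2/σ_k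
# (unit `b2b-balaban-beta-d4-p2`, GEN 4; row D4 of `HOME/BINDER-OWNERS.md`, NODE O′/A.4.0 of the D4 skeletons — MODEL level)

HONEST FRAMING (page 1 of everything the β sub-cell writes): discharging `BetaPertH` makes Bałaban's UV stability
UNCONDITIONAL — a real constructive-QFT result; it is NOT the continuum limit and NOT the Clay problem.  HONEST DEPENDENCY
(cell reorg 2026-08-19, verbatim): «continuum YM on T⁴ ⇐ BetaPertH ∧ nine spine estimates (0/9 proved); BetaPertH ⇐ (D1) ∧
(D4) ∧ CAP+tail; G-an2-4 gates asym, D1 and NE2/3/4.»  THIS MODULE DISCHARGES NOTHING of `BetaPertH`; it asserts NOTHING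
printed and cites nothing as a fact (ABSOLUTE RULE).  It is a kernel theorem about the COMPONENT MODEL of the pv21 lineage
(`Literature/…/Balaban1983to89/B9Thm37GlueTorusCov*`: sites × colours, real isometric bond matrices R(U(b)), covariant block
means with ordered-product transports along comb towers — the model of the k-fold averaging Q_j(U) of [B9] (3.15)/(3.19)
and of the operator Δ′_a = Δ_U + Q′\*aQ′ with the level sum (3.16), (3.23)–(3.24), T. Bałaban, *Propagators for lattice
gauge theories in a background field*, Commun. Math. Phys. 99 (1985) 389–434 = `Balaban1985BackgroundPropagators`).

WHY (row D4).  Every typed road to the (D4) binder (P1 an4, P2″/P2′ this unit, P3 d4-p3) shares the residual NODE O′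
(Bałaban's small-field step OBJECTS as terms) + NODE A ((T2) ⇐ (T3)); NODE A.4.0 = the leading operator of B9 Sects. A–C
with its Thm 3.1/3.3 entries, of which ENTRY 1 is the exponential decay (3.42) of G′(U), «for an arbitrary configuration U».
The pv21 chain holds, at TERM level and for EVERY transport: the tower operator `B9Thm37GlueTorusCovTower.towerOp`, its
coercivity `coercive_towerOp` with σ_k = `sigmaTower` uniform in U and in the volume, its inverse and Dirichlet inverse with
ℓ² bounds (`…CovTowerDir.thm37_l2_tower`) — and DECAY only for the ONE-STEP operator (`B9Thm37GlueTorusCovCT.entry_le`;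
pv21-g14 honest scope (iii): «ℓ² ONLY — NO decay of G′ for the level ∕ tower operator»).  THIS FILE closes that item in
the model: the (3.42)-ENTRY-1 SHAPE for the MULTI-LEVEL operator, by the Combes–Thomas conjugation argument in the
kernel-certified form `Beta.CombesThomasFormOp.combesThomas_form_op`, with the conjugation-error calculus of
`B9Thm37GlueTorusCovCT` generalised from one comb level to arbitrary tower levels.

CONTENT.
* §1 `qPart_gMean_ge` — the block-mean part of the conjugation error for a GENERAL covariant block mean
  G = `gMean blk W T` (SITE weights |W| ≤ w_max, isometric site transports T, blocks of ≤ n sites) under a BLOCK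
  OSCILLATION hypothesis |φ(x) − φ(x′)| ≤ Θ for x, x′ in one block:
  Σ_q G(e^{φ}v)(q)G(e^{−φ}v)(q) − Σ_q (Gv)(q)² ≥ −w_max²(e^{Θ} − 1)n·Σ_p v(p)²  (the transports enter only as isometries).
* §2 `abs_sub_towerBlk_le` / `abs_sub_le_of_towerBlk_eq` — oscillation of a bond-θ-Lipschitz site weight over a
  tower block of level l: ≤ 2θ·S_l, S_l = `towerS D l` = Σ_{j<l} D_j (comb depths), by induction along the chain of
  representatives x → towerBlk₁ x → ⋯ → towerBlk_l x (`B9Thm37GlueTorusCovCT.abs_sub_base_le` per comb).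
* §3 `bilin_levelOp`, `kappaTower`, `conjErr_towerOp_ge` — the bilinear form of the level operator and THE CONJUGATION
  ERROR OF THE TOWER OPERATOR: ERR_φ(Δ_U + Σ_l a_lG_lᵀG_l; v) ≥ −κ_k(θ)·‖v‖²,
  κ_k(θ) = c_max²(e^θ − 1)z + Σ_{l≤k} a_l·w_max²·(e^{2S_lθ} − 1)·N_l, N_l = `towerN n l` — for EVERY transport.
The Combes–Thomas step itself (weighted ℓ² and entrywise decay of the inverse and of the DIRICHLET inverse on Ω₀ with the
constant 2/σ_k resp. 2/min(σ_k, 1), an admissible rate θ_k > 0 with κ_k(θ_k) ≤ σ/2, and the torus instance uniform in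
the volume) is the companion module `CovariantTowerDecayCT`, which imports this one.

NOT ASSERTED (honest scope, as in `B9Thm37GlueTorusCovCT`): anything printed — Thm 3.1/(3.42) of [B9] concern print's
multiscale G′(U) (L^j-blocks, the weighted distance d(y, y′), L^∞-type norms with scale prefactors, the regularity
condition (3.35), constants depending on d and L only); the MODEL statement has ℓ²/entrywise norms, the bond-step distance,
crude constants (σ_k, κ_k from the comb Poincaré constants), no regularity of U (the transports enter only as isometries)
and touches neither the derivative/Hölder entries 2–4 of (3.42)–(3.45) nor the VECTOR-field operators Δ^η(U), G, G_k of
(3.26)–(3.27), nor the random-walk expansion by which [B9] proves Thm 3.1.  For row D4 this is RECORDS value: NODE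
A.4.0's entry 1 (scalar side) at term level WITHOUT an O.2 quantifier IN THE MODEL; the row's class ((T3) open-in-print by
template over located inputs; NODE O.2 vector side term-less) is unchanged; D4 DISCHARGE NO DATE; NOT BetaPertH, NOT
continuum, NOT Clay.  Every declaration is [folklore] (finite-dimensional linear algebra/calculus) about the model.
-/

namespace Summit.QuantumFields.BalabanUV.Beta.CovariantTowerDecay

open Finset
open Literature.MathematicalPhysics.QuantumFieldTheory.Balaban1983to89
open B9Thm37Sum B9Thm37Glue B9Thm37GlueTorusInv B9Thm37GlueTorusCov B9Thm37GlueTorusCovComp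
open B9Thm37GlueTorusCovLevels B9Thm37GlueTorusCovLevelsPoinc B9Thm37GlueTorusCovTower B9Thm37GlueTorusCovTowerDir
open B9Thm37GlueTorusCovCT (expW expW_apply conjErr conjErr_eq_matrix dPart_ge abs_sub_base_le
  exp_add_exp_neg_sub_two_le_of_abs_le)
open Literature.MathematicalPhysics.QuantumFieldTheory.Balaban1983to89.Beta.CombesThomasForm (abs_exp_sub_one_le)
open Literature.MathematicalPhysics.QuantumFieldTheory.Balaban1983to89.Beta.CombesThomasFormOp (combesThomas_form_op)

noncomputable section

/-! ## §1  The block-mean part of the conjugation error for a general covariant block mean -/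

section GeneralLevel

variable {St B Cp : Type}

/-- The transported site vector of a site transport T: g(x)_i = Σ_j T(x)_{ij} v(x, j) (MODEL bookkeeping). [folklore] -/
def gtrT [Fintype Cp] (T : St → Cp → Cp → ℝ) (v : St × Cp → ℝ) (x : St) (i : Cp) : ℝ := ∑ j, T x i j * v (x, j)

/-- The general covariant mean as a block sum of weighted transported site vectors. [folklore] -/
theorem gMean_eq_sum_gtrT [Fintype St] [DecidableEq B] [Fintype Cp] (blk : St → B) (W : St → ℝ)
    (T : St → Cp → Cp → ℝ) (v : St × Cp → ℝ) (β : B) (i : Cp) :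
    gMean blk W T v (β, i) = ∑ x ∈ univ.filter (fun x => blk x = β), W x * gtrT T v x i := by
  rw [gMean_apply, Finset.sum_filter]
  rfl

/-- The general covariant mean of a conjugated field: G(e^{φ}v)(β, i) = Σ_{x ∈ β} W(x)·e^{φ(x)}·g(x)_i. [folklore] -/
theorem gMean_expW [Fintype St] [DecidableEq B] [Fintype Cp] (blk : St → B) (W : St → ℝ)
    (T : St → Cp → Cp → ℝ) (φ : St → ℝ) (v : St × Cp → ℝ) (β : B) (i : Cp) :
    gMean blk W T (expW φ v) (β, i) =
      ∑ x ∈ univ.filter (fun x => blk x = β), Real.exp (φ x) * (W x * gtrT T v x i) := by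
  rw [gMean_apply, Finset.sum_filter]
  refine Finset.sum_congr rfl fun x _ => ?_
  split_ifs with h
  · unfold gtrT
    rw [Finset.mul_sum, Finset.mul_sum, Finset.mul_sum]
    exact Finset.sum_congr rfl fun j _ => by rw [expW_apply]; ring
  · rfl

/-- Σ_β Σ_i Σ_{x ∈ β} g(x)_i² = Σ_p v(p)² for isometric site transports (row isometry `sum_sq_orth_apply` sitewise,
then the fibres of `blk` partition the sites). [folklore] -/
theorem sum_blocks_sq_gtrT [Fintype St] [Fintype B] [DecidableEq B] [Fintype Cp] [DecidableEq Cp] (blk : St → B)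
    {T : St → Cp → Cp → ℝ} (hT : ∀ x i i', ∑ k, T x k i * T x k i' = if i = i' then (1 : ℝ) else 0)
    (v : St × Cp → ℝ) :
    ∑ β, ∑ i, ∑ x ∈ univ.filter (fun x => blk x = β), gtrT T v x i ^ 2 = ∑ p, v p ^ 2 := by
  calc ∑ β, ∑ i, ∑ x ∈ univ.filter (fun x => blk x = β), gtrT T v x i ^ 2
      = ∑ β, ∑ x ∈ univ.filter (fun x => blk x = β), ∑ i, gtrT T v x i ^ 2 :=
        Finset.sum_congr rfl fun β _ => Finset.sum_comm
    _ = ∑ x, ∑ i, gtrT T v x i ^ 2 :=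
        Finset.sum_fiberwise_of_maps_to (s := univ) (t := univ) (g := blk) (fun x _ => mem_univ _) _
    _ = ∑ x, ∑ j, v (x, j) ^ 2 :=
        Finset.sum_congr rfl fun x _ => sum_sq_orth_apply (hT x) (fun j => v (x, j))
    _ = ∑ p, v p ^ 2 := (Fintype.sum_prod_type (fun p : St × Cp => v p ^ 2)).symm

/-- **The G-part of the conjugation error for a GENERAL covariant block mean** G = `gMean blk W T`: SITE weights with
|W(x)| ≤ w_max, isometric site transports, blocks of at most n sites, and a site weight φ whose oscillation over every
block is ≤ Θ (Θ ≥ 0):  Σ_q G(e^{φ}v)(q)·G(e^{−φ}v)(q) − Σ_q (Gv)(q)² ≥ −w_max²·(e^{Θ} − 1)·n·Σ_p v(p)² — the transports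
enter only through the isometry. [folklore] -/
theorem qPart_gMean_ge [Fintype St] [Fintype B] [DecidableEq B] [Fintype Cp] [DecidableEq Cp] (blk : St → B)
    {W : St → ℝ} {wmax : ℝ} (hW : ∀ x, |W x| ≤ wmax) {T : St → Cp → Cp → ℝ}
    (hT : ∀ x i i', ∑ k, T x k i * T x k i' = if i = i' then (1 : ℝ) else 0)
    {n : ℕ} (hn : ∀ β, (univ.filter fun x => blk x = β).card ≤ n) {Θ : ℝ} (hΘ : 0 ≤ Θ) (φ : St → ℝ)
    (hosc : ∀ x x', blk x = blk x' → |φ x - φ x'| ≤ Θ) (v : St × Cp → ℝ) :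
    -(wmax ^ 2 * (Real.exp Θ - 1) * n * ∑ p, v p ^ 2) ≤
      ∑ q, gMean blk W T (expW φ v) q * gMean blk W T (expW (fun x => -φ x) v) q -
        ∑ q, gMean blk W T v q ^ 2 := by
  set Λ := Real.exp Θ - 1 with hΛ
  have hΛ0 : 0 ≤ Λ := by linarith [Real.one_le_exp_iff.mpr hΘ]
  -- the block energies
  set G : B → Cp → ℝ := fun β i => ∑ x ∈ univ.filter (fun x => blk x = β), gtrT T v x i ^ 2 with hG
  have hG0 : ∀ β i, 0 ≤ G β i := fun β i => Finset.sum_nonneg fun x _ => sq_nonneg _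
  have hGsum : ∑ β, ∑ i, G β i = ∑ p, v p ^ 2 := sum_blocks_sq_gtrT blk hT v
  -- termwise bound
  have hterm : ∀ β i, -(wmax ^ 2 * Λ * n * G β i) ≤
      gMean blk W T (expW φ v) (β, i) * gMean blk W T (expW (fun x => -φ x) v) (β, i) -
        gMean blk W T v (β, i) ^ 2 := by
    intro β i
    set s := univ.filter (fun x => blk x = β) with hs
    set h : St → ℝ := fun x => W x * gtrT T v x i with hh
    rw [gMean_expW, gMean_expW, gMean_eq_sum_gtrT]
    -- expand the products
    set X := ∑ x ∈ s, ∑ x' ∈ s, (Real.exp (φ x) * Real.exp (-φ x') - 1) * (h x * h x') with hX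
    have e : (∑ x ∈ s, Real.exp (φ x) * h x) * (∑ x ∈ s, Real.exp (-φ x) * h x) - (∑ x ∈ s, h x) ^ 2 = X := by
      rw [hX, sq, Finset.sum_mul_sum, Finset.sum_mul_sum, ← Finset.sum_sub_distrib]
      refine Finset.sum_congr rfl fun x _ => ?_
      rw [← Finset.sum_sub_distrib]
      exact Finset.sum_congr rfl fun x' _ => by ring
    rw [e]
    -- |X| ≤ Λ (Σ |h|)² ≤ Λ n wmax² G
    have hosc' : ∀ x ∈ s, ∀ x' ∈ s, |Real.exp (φ x) * Real.exp (-φ x') - 1| ≤ Λ := by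
      intro x hx x' hx'
      rw [← Real.exp_add, ← sub_eq_add_neg]
      exact abs_exp_sub_one_le (hosc x x' (((mem_filter.mp hx).2).trans ((mem_filter.mp hx').2).symm))
    have hXle : |X| ≤ Λ * (∑ x ∈ s, |h x|) ^ 2 := by
      calc |X| ≤ ∑ x ∈ s, |∑ x' ∈ s, (Real.exp (φ x) * Real.exp (-φ x') - 1) * (h x * h x')| :=
            Finset.abs_sum_le_sum_abs _ _
        _ ≤ ∑ x ∈ s, ∑ x' ∈ s, |(Real.exp (φ x) * Real.exp (-φ x') - 1) * (h x * h x')| :=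
            Finset.sum_le_sum fun x _ => Finset.abs_sum_le_sum_abs _ _
        _ ≤ ∑ x ∈ s, ∑ x' ∈ s, Λ * (|h x| * |h x'|) := by
            refine Finset.sum_le_sum fun x hx => Finset.sum_le_sum fun x' hx' => ?_
            rw [abs_mul, abs_mul (h x)]
            exact mul_le_mul_of_nonneg_right (hosc' x hx x' hx') (mul_nonneg (abs_nonneg _) (abs_nonneg _))
        _ = Λ * (∑ x ∈ s, |h x|) ^ 2 := by
            rw [sq, Finset.sum_mul_sum, Finset.mul_sum]
            refine Finset.sum_congr rfl fun x _ => ?_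
            rw [Finset.mul_sum]
    have hh2 : ∀ x, |h x| ^ 2 ≤ wmax ^ 2 * gtrT T v x i ^ 2 := fun x => by
      rw [hh]
      simp only
      rw [abs_mul, mul_pow, sq_abs (gtrT T v x i)]
      exact mul_le_mul_of_nonneg_right (pow_le_pow_left₀ (abs_nonneg _) (hW x) 2) (sq_nonneg _)
    have hcs : (∑ x ∈ s, |h x|) ^ 2 ≤ n * (wmax ^ 2 * G β i) := by
      calc (∑ x ∈ s, |h x|) ^ 2 ≤ s.card * ∑ x ∈ s, |h x| ^ 2 := sq_sum_le_card_mul_sum_sq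
        _ ≤ s.card * ∑ x ∈ s, wmax ^ 2 * gtrT T v x i ^ 2 :=
            mul_le_mul_of_nonneg_left (Finset.sum_le_sum fun x _ => hh2 x) (Nat.cast_nonneg _)
        _ = s.card * (wmax ^ 2 * G β i) := by rw [hG, ← Finset.mul_sum]
        _ ≤ n * (wmax ^ 2 * G β i) :=
            mul_le_mul_of_nonneg_right (by exact_mod_cast hn β) (mul_nonneg (sq_nonneg _) (hG0 β i))
    have hX' : |X| ≤ Λ * (n * (wmax ^ 2 * G β i)) := hXle.trans (mul_le_mul_of_nonneg_left hcs hΛ0)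
    have h1 : -(Λ * (n * (wmax ^ 2 * G β i))) ≤ X := (neg_le_neg hX').trans (neg_abs_le X)
    calc -(wmax ^ 2 * Λ * n * G β i) = -(Λ * (n * (wmax ^ 2 * G β i))) := by ring
      _ ≤ X := h1
  -- sum of the termwise bounds
  calc -(wmax ^ 2 * (Real.exp Θ - 1) * n * ∑ p, v p ^ 2)
      = ∑ β, ∑ i, -(wmax ^ 2 * Λ * n * G β i) := by
        rw [← hGsum, Finset.mul_sum, ← Finset.sum_neg_distrib]
        refine Finset.sum_congr rfl fun β _ => ?_
        rw [Finset.mul_sum, ← Finset.sum_neg_distrib]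
    _ ≤ ∑ β, ∑ i, (gMean blk W T (expW φ v) (β, i) * gMean blk W T (expW (fun x => -φ x) v) (β, i) -
          gMean blk W T v (β, i) ^ 2) :=
        Finset.sum_le_sum fun β _ => Finset.sum_le_sum fun i _ => hterm β i
    _ = _ := by
        rw [← Finset.sum_sub_distrib, Fintype.sum_prod_type]

end GeneralLevel

/-! ## §2  Oscillation of a bond-Lipschitz site weight over a tower block -/

section TowerOscillation

variable {St Bd Cp : Type} {src tgt : Bd → St} {Bs : ℕ → Type} (Ks : ∀ j, Comb src tgt (Bs j))

/-- MODEL bookkeeping: **the accumulated comb depth below level l**, S_l = Σ_{j<l} D_j (S₀ = 0, S_{l+1} = S_l + D_l).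
[folklore] -/
def towerS (D : ℕ → ℕ) : ℕ → ℕ
  | 0 => 0
  | l + 1 => towerS D l + D l

/-- S₀ = 0. [folklore] -/
theorem towerS_zero (D : ℕ → ℕ) : towerS D 0 = 0 := rfl

/-- S_{l+1} = S_l + D_l. [folklore] -/
theorem towerS_succ (D : ℕ → ℕ) (l : ℕ) : towerS D (l + 1) = towerS D l + D l := rfl

/-- **Oscillation along the chain of representatives**: for a site weight φ with |φ(b₊) − φ(b₋)| ≤ θ on every bond
(θ ≥ 0) and combs K_j of depth ≤ D_j, |φ(x) − φ(towerBlk_l x)| ≤ S_l·θ (induction on l with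
`B9Thm37GlueTorusCovCT.abs_sub_base_le` for the comb K_l at the level-l representative). [folklore] -/
theorem abs_sub_towerBlk_le (φ : St → ℝ) {θ : ℝ} (hθ : 0 ≤ θ) (hφ : ∀ b, |φ (tgt b) - φ (src b)| ≤ θ)
    {D : ℕ → ℕ} (hD : ∀ j x, (Ks j).depth x ≤ D j) :
    ∀ l x, |φ x - φ (towerBlk Ks l x)| ≤ (towerS D l : ℝ) * θ := by
  intro l
  induction l with
  | zero =>
      intro x
      rw [towerBlk_zero, sub_self, abs_zero, towerS_zero, Nat.cast_zero, zero_mul]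
  | succ l ih =>
      intro x
      rw [towerBlk_succ, towerS_succ]
      have h1 := ih x
      have h2 := abs_sub_base_le (Ks l) φ hφ (towerBlk Ks l x)
      have h3 : ((Ks l).depth (towerBlk Ks l x) : ℝ) * θ ≤ (D l : ℝ) * θ :=
        mul_le_mul_of_nonneg_right (by exact_mod_cast hD l _) hθ
      push_cast
      calc |φ x - φ ((Ks l).base ((Ks l).blk (towerBlk Ks l x)))|
          ≤ |φ x - φ (towerBlk Ks l x)| +
              |φ (towerBlk Ks l x) - φ ((Ks l).base ((Ks l).blk (towerBlk Ks l x)))| := abs_sub_le _ _ _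
        _ ≤ towerS D l * θ + D l * θ := add_le_add h1 (h2.trans h3)
        _ = (towerS D l + D l) * θ := by ring

/-- **Oscillation over a tower block**: towerBlk_l x = towerBlk_l x′ ⇒ |φ(x) − φ(x′)| ≤ 2·S_l·θ. [folklore] -/
theorem abs_sub_le_of_towerBlk_eq (φ : St → ℝ) {θ : ℝ} (hθ : 0 ≤ θ) (hφ : ∀ b, |φ (tgt b) - φ (src b)| ≤ θ)
    {D : ℕ → ℕ} (hD : ∀ j x, (Ks j).depth x ≤ D j) {l : ℕ} {x x' : St}
    (h : towerBlk Ks l x = towerBlk Ks l x') : |φ x - φ x'| ≤ 2 * (towerS D l : ℝ) * θ := by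
  have hx := abs_sub_towerBlk_le Ks φ hθ hφ hD l x
  have hx' := abs_sub_towerBlk_le Ks φ hθ hφ hD l x'
  rw [← h] at hx'
  calc |φ x - φ x'| ≤ |φ x - φ (towerBlk Ks l x)| + |φ (towerBlk Ks l x) - φ x'| := abs_sub_le _ _ _
    _ ≤ towerS D l * θ + towerS D l * θ := add_le_add hx (by rw [abs_sub_comm]; exact hx')
    _ = 2 * (towerS D l : ℝ) * θ := by ring

end TowerOscillation

/-! ## §3  The bilinear form of the level operator and the conjugation error of the tower operator -/

section LevelBilinear

variable {St Bd B Cp J : Type} [Fintype St] [DecidableEq St] [Fintype Bd] [Fintype B] [DecidableEq B] [Fintype Cp]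
  [Fintype J] (src tgt : Bd → St) (c : Bd → ℝ) (Rm : Bd → Cp → Cp → ℝ)

omit [DecidableEq St] [Fintype Bd] in
/-- The bilinear form of the level sum: Σ_p u(p)(Σ_j a_jG_jᵀG_j v)(p) = Σ_j a_j Σ_q (G_j u)(q)(G_j v)(q) (the bilinear
version of `B9Thm37GlueTorusCovLevels.qform_levelSum`). [folklore] -/
theorem bilin_levelSum (blk : J → St → B) (W : J → St → ℝ) (T : J → St → Cp → Cp → ℝ) (a : J → ℝ)
    (u v : St × Cp → ℝ) :
    ∑ p, u p * levelSum blk W T a v p =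
      ∑ j, a j * ∑ q, gMean (blk j) (W j) (T j) u q * gMean (blk j) (W j) (T j) v q := by
  calc ∑ p, u p * levelSum blk W T a v p
      = ∑ p, ∑ j, a j * (u p * gMeanT (blk j) (W j) (T j) (gMean (blk j) (W j) (T j) v) p) := by
          refine Finset.sum_congr rfl fun p _ => ?_
          rw [levelSum_apply, Finset.mul_sum]
          exact Finset.sum_congr rfl fun j _ => by ring
    _ = ∑ j, ∑ p, a j * (u p * gMeanT (blk j) (W j) (T j) (gMean (blk j) (W j) (T j) v) p) := Finset.sum_comm
    _ = ∑ j, a j * ∑ q, gMean (blk j) (W j) (T j) u q * gMean (blk j) (W j) (T j) v q := by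
          refine Finset.sum_congr rfl fun j _ => ?_
          rw [← Finset.mul_sum, ← isTransposePair_gMean (blk j) (W j) (T j) u (gMean (blk j) (W j) (T j) v)]

/-- **The bilinear form of the level operator**: Σ_p u(p)((Δ_U + Σ_j a_jG_jᵀG_j)v)(p) =
Σ_b (∇_U u)(b)(∇_U v)(b) + Σ_j a_j Σ_q (G_j u)(q)(G_j v)(q) (the bilinear version of
`B9Thm37GlueTorusCovLevels.qform_levelOp`). [folklore] -/
theorem bilin_levelOp (blk : J → St → B) (W : J → St → ℝ) (T : J → St → Cp → Cp → ℝ) (a : J → ℝ)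
    (u v : St × Cp → ℝ) :
    ∑ p, u p * levelOp src tgt c Rm blk W T a v p =
      ∑ q, covD src tgt c Rm u q * covD src tgt c Rm v q +
        ∑ j, a j * ∑ q, gMean (blk j) (W j) (T j) u q * gMean (blk j) (W j) (T j) v q := by
  rw [isTransposePair_covD src tgt c Rm u (covD src tgt c Rm v), ← bilin_levelSum, ← Finset.sum_add_distrib]
  refine Finset.sum_congr rfl fun p _ => ?_
  simp only [levelOp, LinearMap.add_apply, Pi.add_apply, LinearMap.comp_apply]
  ring

end LevelBilinear

section TowerError

variable {St Bd Cp : Type} [Fintype St] [DecidableEq St] [Fintype Bd] [Fintype Cp] [DecidableEq Cp]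
  {src tgt : Bd → St} {Bs : ℕ → Type} [∀ j, Fintype (Bs j)] [∀ j, DecidableEq (Bs j)]
  (Ks : ∀ j, Comb src tgt (Bs j)) (Rm : Bd → Cp → Cp → ℝ)

/-- **The smallness functional of the Combes–Thomas argument for the tower** (MODEL bookkeeping):
κ_k(θ) = c_max²(e^θ − 1)z + Σ_{l≤k} a_l·w_max²·(e^{2S_lθ} − 1)·N_l, with S_l = `towerS D l` the accumulated comb depth
and N_l = `towerN n l` the block-size bound of level l. [folklore] -/
def kappaTower (θ cmax wmax : ℝ) (z : ℕ) (D n : ℕ → ℕ) (k : ℕ) (a : Fin (k + 1) → ℝ) : ℝ :=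
  cmax ^ 2 * (Real.exp θ - 1) * z +
    ∑ l : Fin (k + 1), a l * (wmax ^ 2 * (Real.exp (2 * (towerS D l : ℝ) * θ) - 1) * (towerN n l : ℝ))

omit [∀ j, Fintype (Bs j)] in
/-- **THE CONJUGATION ERROR OF THE TOWER OPERATOR Δ_U + Σ_{l≤k} a_l·G_lᵀG_l** (MODEL): isometric bond matrices,
|c(b)| ≤ c_max, SITE weights |W_l(x)| ≤ w_max, a_l ≥ 0, combs K_j of depth ≤ D_j with blocks of ≤ n_j sites, bond
degrees ≤ z and a site weight with |φ(b₊) − φ(b₋)| ≤ θ (θ ≥ 0):  ERR_φ(Δ_U + Σ_l a_lG_lᵀG_l; v) ≥ −κ_k(θ)·Σ_p v(p)²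
for EVERY field v — uniform in the transport (the ∇_U-part is `B9Thm37GlueTorusCovCT.dPart_ge`; level l contributes
`qPart_gMean_ge` with block oscillation 2S_lθ of `abs_sub_le_of_towerBlk_eq`, isometry `towerTr_orth`, block size
`card_towerBlk_fibre_le`). [folklore] -/
theorem conjErr_towerOp_ge (hRm : ∀ b i j, ∑ k, Rm b k i * Rm b k j = if i = j then (1 : ℝ) else 0)
    {c : Bd → ℝ} {cmax : ℝ} (hc' : ∀ b, |c b| ≤ cmax) {D n : ℕ → ℕ} (hD : ∀ j x, (Ks j).depth x ≤ D j)
    (hn : ∀ j β, (univ.filter fun x => (Ks j).blk x = β).card ≤ n j) (k : ℕ) {W : Fin (k + 1) → St → ℝ}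
    {wmax : ℝ} (hW : ∀ l x, |W l x| ≤ wmax) {a : Fin (k + 1) → ℝ} (ha : ∀ l, 0 ≤ a l) {θ : ℝ} (hθ : 0 ≤ θ)
    (φ : St → ℝ) (hφ : ∀ b, |φ (tgt b) - φ (src b)| ≤ θ) {z : ℕ}
    (hzs : ∀ x, (univ.filter fun b => src b = x).card ≤ z) (hzt : ∀ x, (univ.filter fun b => tgt b = x).card ≤ z)
    (v : St × Cp → ℝ) :
    -(kappaTower θ cmax wmax z D n k a * ∑ p, v p ^ 2) ≤ conjErr (towerOp Ks Rm c k W a) φ v := by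
  unfold conjErr towerOp
  rw [bilin_levelOp, bilin_levelOp]
  set S := ∑ p, v p ^ 2 with hS
  set X' : Fin (k + 1) → ℝ := fun l => ∑ q, gMean (towerBlk Ks (l : ℕ)) (W l) (towerTr Ks Rm (l : ℕ)) (expW φ v) q *
    gMean (towerBlk Ks (l : ℕ)) (W l) (towerTr Ks Rm (l : ℕ)) (expW (fun x => -φ x) v) q with hX'
  set X : Fin (k + 1) → ℝ := fun l => ∑ q, gMean (towerBlk Ks (l : ℕ)) (W l) (towerTr Ks Rm (l : ℕ)) v q *
    gMean (towerBlk Ks (l : ℕ)) (W l) (towerTr Ks Rm (l : ℕ)) v q with hX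
  set Kl : Fin (k + 1) → ℝ := fun l =>
    wmax ^ 2 * (Real.exp (2 * (towerS D l : ℝ) * θ) - 1) * (towerN n l : ℝ) with hKl
  -- the ∇_U-part
  have hd := dPart_ge c Rm hRm hc' hθ φ hφ hzs hzt v
  have hsq1 : ∑ q, covD src tgt c Rm v q * covD src tgt c Rm v q = ∑ q, covD src tgt c Rm v q ^ 2 :=
    Finset.sum_congr rfl fun q _ => (sq _).symm
  -- the levels
  have hq : ∀ l : Fin (k + 1), -(Kl l * S) ≤ X' l - X l := by
    intro l
    have h := qPart_gMean_ge (towerBlk Ks (l : ℕ)) (hW l) (towerTr_orth Ks Rm hRm (l : ℕ))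
      (card_towerBlk_fibre_le Ks hn (l : ℕ)) (by positivity : (0 : ℝ) ≤ 2 * (towerS D l : ℝ) * θ) φ
      (fun x x' hxx' => abs_sub_le_of_towerBlk_eq Ks φ hθ hφ hD hxx') v
    have e : ∑ q, gMean (towerBlk Ks (l : ℕ)) (W l) (towerTr Ks Rm (l : ℕ)) v q ^ 2 = X l :=
      Finset.sum_congr rfl fun q _ => sq _
    rw [e] at h
    simpa only [hKl, hS, mul_assoc] using h
  have hql : ∀ l : Fin (k + 1), -(a l * (Kl l * S)) ≤ a l * (X' l - X l) := fun l => by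
    have h := mul_le_mul_of_nonneg_left (hq l) (ha l)
    linarith
  have hqs : -(∑ l, a l * (Kl l * S)) ≤ ∑ l, a l * (X' l - X l) := by
    rw [← Finset.sum_neg_distrib]
    exact Finset.sum_le_sum fun l _ => hql l
  -- assembly
  have e1 : (∑ q, covD src tgt c Rm (expW φ v) q * covD src tgt c Rm (expW (fun x => -φ x) v) q + ∑ l, a l * X' l) -
      (∑ q, covD src tgt c Rm v q * covD src tgt c Rm v q + ∑ l, a l * X l) =
        (∑ q, covD src tgt c Rm (expW φ v) q * covD src tgt c Rm (expW (fun x => -φ x) v) q -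
          ∑ q, covD src tgt c Rm v q ^ 2) + ∑ l, a l * (X' l - X l) := by
    rw [hsq1, Finset.sum_congr rfl fun l _ => mul_sub (a l) (X' l) (X l), Finset.sum_sub_distrib]
    ring
  have e2 : kappaTower θ cmax wmax z D n k a * S =
      cmax ^ 2 * (Real.exp θ - 1) * z * S + ∑ l, a l * (Kl l * S) := by
    unfold kappaTower
    rw [add_mul, Finset.sum_mul]
    exact congrArg _ (Finset.sum_congr rfl fun l _ => by rw [hKl]; ring)
  rw [e1, e2]
  linarith [hd, hqs]

end TowerError

end

end Summit.QuantumFields.BalabanUV.Beta.CovariantTowerDecay
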